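import Summits.BirchSwinnertonDyer.BirchSwinnertonDyer.Theorems.KatoDescentTamePotSupersingularTameLowerFouquetRoadCited
import Literature.NumberTheory.EllipticCurves.BSDSelmerPConverseSerreProofs
import HarnessLib

/-!
# Route `KatoDescentTamePotSupersingular` (rung K8, sub-rung B4 (t′), cell `bsd-potss`): the Fouquet ordinary-seed road to
# L₀ (items 19981 / 19618) with the SEED displayed by THREE census bits — good ordinary, `ρ̄_{G,p}` onto, a ramified
# multiplicative prime — instead of five (a `--supports … --as helper` file; seat bsd-potss-k8t-c2, generation 5)

The road file `…TameLowerFouquetRoadCited.lean` (p446605) displays the Skinner–Urban seed `G` with `Irr G p` AND the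
`p`-adic tower surjectivity `∀ n, ρ̄_{G,p^n}` onto (Kato's (12.5.2) / S–U's integral clause). Both are THEOREMS of the tree
from `ρ̄_{G,p}` onto at `p ≥ 5`: irreducibility (`hasIrreducibleModPGaloisRep_of_hasSurjectiveModNGaloisRep`) and Serre's
lifting lemma (`serre_hasSurjectiveModNGaloisRep_pow_holds`, *Abelian ℓ-adic representations* IV §3.4, PROVED in
`BSDSelmerPConverseSerreProofs.lean`). So the census certificate of a seed row shrinks to: `GoodOrd G p`, `Surj G p`,
`Ram G p`, the trace congruence off `p N_W N_G`, and level compatibility — exactly cc-eng-2's D1 partner columns. This file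
states the class forms of p446605 §3 over that shorter seed clause (the statements the planner may prefer for the
seed-rows child of 19618, memo `HOME/k8t-c2/KT-SEED-SPLIT-19618-k8t-c2-g5.md`). Conditional on the cite-level fact
`Fouquet2025.padicValRat_bsd_rank_zero_of_ordinaryCongruence` (p446173) + GZK + modularity; nothing credited; the items are
NOT closed; BSD is not proved by any of this.

References: [Fouquet2025EquivariantTNC] Thm 4.1, Thm 1.7 (2); [SkinnerUrban2014] Thm 3.6.9 (p. 45);
[SerreAbelianLadic1968] Ch. IV §3.4 Lemma 3; [Miller2011LMS] Def. 1.1.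
-/

set_option autoImplicit false
-- sibling precedent (`KatoDescentTamePotSupersingularAssembly.lean`): the directory name repeats the summit name
set_option linter.dupNamespace false

noncomputable section

open scoped Classical

namespace Summit.BirchSwinnertonDyer.BirchSwinnertonDyer.Theorems

open WeierstrassCurve Literature.NumberTheory.EllipticCurves
  Literature.NumberTheory.EllipticCurves.ModularForms
  Literature.NumberTheory.EllipticCurves.Rank1Residual
  Literature.NumberTheory.EllipticCurves.Rank1Residual.Typed
  Summit.BirchSwinnertonDyer.Rank1Residual.Additive
  Summit.BirchSwinnertonDyer.Rank1Residual
  Summit.BirchSwinnertonDyer.BirchSwinnertonDyer.Theses.KatoDescentTamePotSupersingular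

/-- **L₀ on the (t′) Fouquet-seed rows, seed displayed by `GoodOrd ∧ Surj ∧ Ram` + congruence + level** (the tower
surjectivity and the irreducibility of `G[p]` are derived: Serre's lemma `serre_hasSurjectiveModNGaloisRep_pow_holds`,
`p ≥ 5`, and `hasIrreducibleModPGaloisRep_of_hasSurjectiveModNGaloisRep`). Same conclusion and same three named
inputs as `tameLowerHalf_fouquetSeedRows_of_fact`. Conditional; nothing credited.
[cite: Fouquet2025EquivariantTNC, Thm 4.1 and Thm 1.7 (2)] [cite: SkinnerUrban2014, Thm 3.6.9 (p. 45)]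
[cite: SerreAbelianLadic1968, Ch. IV §3.4 Lemma 3] [cite: Miller2011LMS, Def. 1.1] -/
theorem tameLowerHalf_fouquetSeedRows_of_fact_of_surjSeed
    (hF : Fouquet2025.padicValRat_bsd_rank_zero_of_ordinaryCongruence)
    (hGZK : rank_eq_analyticRank_of_analyticRank_le_one) (hmod : hasEntireLFunction_rat) :
    ∀ (W : WeierstrassCurve ℚ) [W.IsElliptic] [W.IsGloballyMinimal] (p : ℕ) [Fact p.Prime],
      W.analyticRank = 0 → 5 ≤ p → Addv W p → SubTprime W p → Surj W p → FouquetGenericAt p W →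
      FouquetEligibleAt p W →
      (∃ (G : WeierstrassCurve ℚ) (_ : G.IsElliptic) (_ : G.IsGloballyMinimal),
        GoodOrd G p ∧ Surj G p ∧ Ram G p ∧ IsCongruentModP p W G ∧ FouquetLevelCompatibleAt p W G) →
      MissingLowerBoundAt W p := by
  intro W _ _ p _ hr hp hadd hT hsurj hgen helig hseed
  obtain ⟨G, hGe, hGm, hord, hsurjG, hramG, hcong, hlev⟩ := hseed
  exact tameMissingLowerBoundAt_of_fouquetOrdinaryCongruence hF hmod hGZK W G p hp hr hadd hsurj hgen helig hord
    (hasIrreducibleModPGaloisRep_of_hasSurjectiveModNGaloisRep G p hsurjG) hramG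
    (serre_hasSurjectiveModNGaloisRep_pow_holds G p hp hsurjG) hcong hlev

/-- **Both halves (`MissingPPartAt`) on the same rows, seed displayed by `GoodOrd ∧ Surj ∧ Ram` + congruence + level.**
Conditional; nothing credited. [cite: Fouquet2025EquivariantTNC, Thm 1.7 (2) (p. 7)] [cite: Miller2011LMS, Def. 1.1] -/
theorem tameMissingPPartAt_fouquetSeedRows_of_fact_of_surjSeed
    (hF : Fouquet2025.padicValRat_bsd_rank_zero_of_ordinaryCongruence)
    (hGZK : rank_eq_analyticRank_of_analyticRank_le_one) (hmod : hasEntireLFunction_rat) :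
    ∀ (W : WeierstrassCurve ℚ) [W.IsElliptic] [W.IsGloballyMinimal] (p : ℕ) [Fact p.Prime],
      W.analyticRank = 0 → 5 ≤ p → Addv W p → SubTprime W p → Surj W p → FouquetGenericAt p W →
      FouquetEligibleAt p W →
      (∃ (G : WeierstrassCurve ℚ) (_ : G.IsElliptic) (_ : G.IsGloballyMinimal),
        GoodOrd G p ∧ Surj G p ∧ Ram G p ∧ IsCongruentModP p W G ∧ FouquetLevelCompatibleAt p W G) →
      MissingPPartAt W p := by
  intro W _ _ p _ hr hp hadd _ hsurj hgen helig hseed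
  obtain ⟨G, hGe, hGm, hord, hsurjG, hramG, hcong, hlev⟩ := hseed
  exact missingPPartAt_rankZero_of_fouquetOrdinaryCongruence hF hmod hGZK W G p hp hr hadd hsurj hgen helig hord
    (hasIrreducibleModPGaloisRep_of_hasSurjectiveModNGaloisRep G p hsurjG) hramG
    (serre_hasSurjectiveModNGaloisRep_pow_holds G p hp hsurjG) hcong hlev

end Summit.BirchSwinnertonDyer.BirchSwinnertonDyer.Theorems

end
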